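import Summits.Ventures.HodgeRepro2.T5SU11ImproperEnergyBracketAll
import Summits.Ventures.HodgeRepro2.T5SU11ResolventEnergyPieces

/-!
# The energy identity of the resolvent on the exponentially decaying class, for every `λ > 1`

Row 527 for every `λ > 1` (rows 529–530 supply the bounds of `u′` without the restriction `λ > 2`): for a source `g` of
the exponentially decaying class at a rate `ε > 1`, with `u = G^I_λ g`, row 474's
energy identity on `[ε₀, R]`, `∫_{ε₀}^R (sinh 2t u′² + μ sinh 2t u² + sinh 2t g u) = E(R) − E(ε₀)`, passes to the limits
`ε₀ → 0⁺` (the integrand is bounded near `0`, `E(ε₀) → 0`) and `R → ∞` (the integrand is integrable on `(0, ∞)`,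
`E(R) → 0`; row 526), giving

**`∫_{(0,∞)} sinh 2t (u′)² + μ ∫_{(0,∞)} sinh 2t u² = −∫_{(0,∞)} sinh 2t g u`** (`energy_identity_class`),

for every `λ > 1` (`energy_identity_class`), and for `λ ≥ 2` the non-positivity `⟨g, G^I_λ g⟩ ≤ 0`
(`inner_greenSolI_nonpos`); the range `1 < λ < 2` is handled by the Hardy inequality on the class (next row).
Nothing is claimed about (N).

Blind lane: Mathlib + the HodgeRepro2 prefix only; no sorry; axioms ⊆ {propext, Classical.choice,
Quot.sound}.
-/

namespace Summit.Ventures.HodgeRepro2.T5SU11ImproperEnergyIdentityAll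

open Filter Topology MeasureTheory intervalIntegral
open Set (Ioi Ioc Icc Ioo)
open T5SU11Cartan T5SU11SphericalFunction T5SU11SphericalBounds T5SU11SphericalContinuous
  T5SU11SphericalSolutionSpaceAll T5SU11SphericalDecay T5SU11RadialGreenImproper T5SU11RadialGreenImproperOrigin
  T5SU11RadialGreenImproperDecaySource T5SU11RadialGreenImproperStable T5SU11ResolventEnergyPieces
  T5SU11ImproperDerivativeIdentity T5SU11ImproperDerivativeBoundsAll T5SU11ImproperEnergyBracketAll

section measure

variable [MeasurableSpace Circle] [BorelSpace Circle]

variable {lam : ℝ} (hlam : 1 < lam) {g : ℝ → ℝ} (hg : ContinuousOn g (Ioi 0))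
  {M : ℝ} (hM : ∀ s ∈ Ioc (0 : ℝ) 1, |g s| ≤ M) (hM0 : 0 ≤ M)
  {ε C s₀ : ℝ} (hε : 2 - lam < ε) (hC : ∀ s, s₀ ≤ s → |g s| ≤ C * Real.exp (-ε * s))
  (hε1 : 1 < ε)

include hlam hg hM hM0 hε hC hε1 in
/-- **THE ENERGY IDENTITY OF THE RESOLVENT ON THE CLASS**:
`∫_{(0,∞)} sinh 2t (u′)² + μ ∫_{(0,∞)} sinh 2t u² = −∫_{(0,∞)} sinh 2t · g u` for `u = G^I_λ g`, `λ > 1`, `ε > 1`. -/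
theorem energy_identity_class :
    (∫ t in Ioi 0, Real.sinh (2 * t) * greenSolI' (deriv fun t => sph lam (hyp t)) (sphDecay' lam)
        (fun t => sph lam (hyp t)) (sphDecay lam) g t ^ 2)
      + lam * (lam - 2) * ∫ t in Ioi 0, Real.sinh (2 * t) * greenSolI (fun t => sph lam (hyp t)) (sphDecay lam) g t ^ 2
      = -∫ t in Ioi 0, Real.sinh (2 * t) * (g t * greenSolI (fun t => sph lam (hyp t)) (sphDecay lam) g t) := by
  set u := greenSolI (fun t => sph lam (hyp t)) (sphDecay lam) g with hu_def
  set u' := greenSolI' (deriv fun t => sph lam (hyp t)) (sphDecay' lam) (fun t => sph lam (hyp t)) (sphDecay lam) g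
    with hu'_def
  set F : ℝ → ℝ := fun t => Real.sinh (2 * t) * u' t ^ 2 + lam * (lam - 2) * (Real.sinh (2 * t) * u t ^ 2)
    + Real.sinh (2 * t) * (g t * u t) with hF
  set E : ℝ → ℝ := fun t => Real.sinh (2 * t) * (u t * u' t) with hE
  -- derivative data of `u`
  have hB := integrableOn_sph_mul_mul_sinh_Ioc hg hM hM0 lam
  have hA := integrableOn_sphDecay_mul_mul_sinh hlam hg hM hM0 hε hC
  have hu : ∀ t, 0 < t → HasDerivAt u (u' t) t :=
    fun t ht => hasDerivAt_greenSolI (hφ_sph lam) (fun _ hs => hasDerivAt_sphDecay hlam hs) hg hB hA ht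
  have hu' : ∀ t, 0 < t → HasDerivAt u' (greenSolI'' (deriv (deriv fun t => sph lam (hyp t))) (sphDecay'' lam)
      (deriv fun t => sph lam (hyp t)) (sphDecay' lam) (fun t => sph lam (hyp t)) (sphDecay lam) g t) t :=
    fun t ht => hasDerivAt_greenSolI' (hφ_sph lam) (hφ'_sph lam) (fun _ hs => hasDerivAt_sphDecay hlam hs)
      (fun _ hs => hasDerivAt_sphDecay' lam hs) hg hB hA ht
  have huode : ∀ t, 0 < t → Real.sinh (2 * t) * greenSolI'' (deriv (deriv fun t => sph lam (hyp t))) (sphDecay'' lam)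
      (deriv fun t => sph lam (hyp t)) (sphDecay' lam) (fun t => sph lam (hyp t)) (sphDecay lam) g t
      + 2 * Real.cosh (2 * t) * u' t = lam * (lam - 2) * Real.sinh (2 * t) * u t + Real.sinh (2 * t) * g t :=
    fun t ht => greenSolI_ode (hode_sph lam) (fun _ hs => sphDecay_ode hlam hs) (fun _ hs => wronskian_sphDecay hlam hs)
      (g := g) ht
  -- the three energy terms are integrable, hence `F`
  have hI1 := integrableOn_sinh_mul_greenSolI'_sq hlam hg hM hM0 hε hC hε1
  have hI2 := integrableOn_sinh_mul_greenSolI_sq hlam hg hM hM0 hε hC hε1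
  have hI3 := integrableOn_sinh_mul_mul_greenSolI hlam hg hM hM0 hε hC hε1
  have hIF : IntegrableOn F (Ioi 0) := (hI1.add (hI2.const_mul (lam * (lam - 2)))).add hI3
  -- the identity on `[ε₀, R]`
  have hfin : ∀ ε₀ R, 0 < ε₀ → ε₀ ≤ R → ∫ t in ε₀..R, F t = E R - E ε₀ :=
    fun ε₀ R hε₀ hεR => energy_identity_inhom hu hu' huode hg hε₀ hεR
  -- `F` is bounded near `0`
  obtain ⟨B, hB⟩ := eventually_abs_greenSolI_le hlam hM hM0 hA
  obtain ⟨B', hB'⟩ := eventually_abs_greenSolI'_le_all hlam hg hM hM0 hε hC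
  have hFbdd : ∀ᶠ t in 𝓝[>] (0 : ℝ), |F t| ≤ Real.sinh 2 * (|B'| ^ 2 + |lam * (lam - 2)| * |B| ^ 2 + M * |B|) := by
    filter_upwards [hB, hB', Ioo_mem_nhdsGT one_pos] with t hBt hB't ht
    have hsinh : 0 ≤ Real.sinh (2 * t) := Real.sinh_nonneg_iff.mpr (by linarith [ht.1])
    have hsinh2 : Real.sinh (2 * t) ≤ Real.sinh 2 := Real.sinh_le_sinh.mpr (by linarith [ht.2])
    have hgt : |g t| ≤ M := hM t ⟨ht.1, ht.2.le⟩
    have e1 : |u' t| ^ 2 ≤ |B'| ^ 2 := pow_le_pow_left₀ (abs_nonneg _) (le_trans hB't (le_abs_self _)) 2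
    have e2 : |u t| ^ 2 ≤ |B| ^ 2 := pow_le_pow_left₀ (abs_nonneg _) (le_trans hBt (le_abs_self _)) 2
    have e3 : |g t| * |u t| ≤ M * |B| := mul_le_mul hgt (le_trans hBt (le_abs_self _)) (abs_nonneg _) hM0
    calc |F t| ≤ |Real.sinh (2 * t) * u' t ^ 2| + |lam * (lam - 2) * (Real.sinh (2 * t) * u t ^ 2)|
          + |Real.sinh (2 * t) * (g t * u t)| := abs_add_three _ _ _
      _ = Real.sinh (2 * t) * |u' t| ^ 2 + |lam * (lam - 2)| * (Real.sinh (2 * t) * |u t| ^ 2)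
          + Real.sinh (2 * t) * (|g t| * |u t|) := by
          simp only [abs_mul, abs_pow, abs_of_nonneg hsinh]
      _ ≤ Real.sinh 2 * |B'| ^ 2 + |lam * (lam - 2)| * (Real.sinh 2 * |B| ^ 2) + Real.sinh 2 * (M * |B|) := by
          gcongr
      _ = Real.sinh 2 * (|B'| ^ 2 + |lam * (lam - 2)| * |B| ^ 2 + M * |B|) := by ring
  -- `ε₀ → 0⁺` for fixed `R`: `∫_0^R F = E(R)`
  have hzero : ∀ R, 1 ≤ R → ∫ t in (0 : ℝ)..R, F t = E R := by
    intro R hR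
    obtain ⟨δ, hδ, hδB⟩ := mem_nhdsGT_iff_exists_Ioo_subset.mp hFbdd
    have hδ0 : 0 < δ := hδ
    set B₀ := Real.sinh 2 * (|B'| ^ 2 + |lam * (lam - 2)| * |B| ^ 2 + M * |B|) with hB₀
    have hIR : IntegrableOn F (Ioc 0 R) := hIF.mono_set Set.Ioc_subset_Ioi_self
    -- the identity `∫_0^R F = E R − E ε₀ + ∫_0^{ε₀} F` for `0 < ε₀ < min δ R`
    have hsplit : ∀ ε₀, 0 < ε₀ → ε₀ < R → ∫ t in (0 : ℝ)..R, F t = (E R - E ε₀) + ∫ t in (0 : ℝ)..ε₀, F t := by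
      intro ε₀ hε₀ hε₀R
      have hi1 : IntervalIntegrable F volume 0 ε₀ :=
        (intervalIntegrable_iff_integrableOn_Ioc_of_le hε₀.le).mpr
          (hIR.mono_set (Set.Ioc_subset_Ioc_right hε₀R.le))
      have hi2 : IntervalIntegrable F volume ε₀ R :=
        (intervalIntegrable_iff_integrableOn_Ioc_of_le hε₀R.le).mpr
          (hIR.mono_set (Set.Ioc_subset_Ioc_left hε₀.le))
      rw [← integral_add_adjacent_intervals hi1 hi2, hfin ε₀ R hε₀ hε₀R.le]
      ring
    -- the limit `ε₀ → 0⁺` of the right-hand side is `E R`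
    have hlim : Tendsto (fun ε₀ => (E R - E ε₀) + ∫ t in (0 : ℝ)..ε₀, F t) (𝓝[>] 0) (𝓝 (E R)) := by
      have h1 : Tendsto (fun ε₀ => E R - E ε₀) (𝓝[>] (0 : ℝ)) (𝓝 (E R - 0)) :=
        tendsto_const_nhds.sub (tendsto_energy_bracket_nhdsGT_zero hlam hg hM hM0 hε hC)
      have h2' : Tendsto (fun ε₀ => ∫ t in (0 : ℝ)..ε₀, F t) (𝓝[>] (0 : ℝ)) (𝓝 0) := by
        have hlimB : Tendsto (fun ε₀ : ℝ => B₀ * |ε₀ - 0|) (𝓝[>] (0 : ℝ)) (𝓝 0) := by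
          have : Tendsto (fun ε₀ : ℝ => B₀ * |ε₀ - 0|) (𝓝 0) (𝓝 (B₀ * |(0 : ℝ) - 0|)) :=
            (continuous_const.mul ((continuous_id.sub continuous_const).abs)).tendsto 0
          rw [show B₀ * |(0 : ℝ) - 0| = 0 by simp] at this
          exact this.mono_left nhdsWithin_le_nhds
        refine squeeze_zero_norm' ?_ hlimB
        filter_upwards [Ioo_mem_nhdsGT hδ0] with ε₀ hε₀
        refine intervalIntegral.norm_integral_le_of_norm_le_const fun t ht => ?_
        rw [Set.uIoc_of_le hε₀.1.le] at ht
        rw [Real.norm_eq_abs]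
        exact hδB ⟨ht.1, lt_of_le_of_lt ht.2 hε₀.2⟩
      have := h1.add h2'
      simpa using this
    have hconst : Tendsto (fun _ : ℝ => ∫ t in (0 : ℝ)..R, F t) (𝓝[>] (0 : ℝ)) (𝓝 (∫ t in (0 : ℝ)..R, F t)) :=
      tendsto_const_nhds
    refine tendsto_nhds_unique hconst (hlim.congr' ?_)
    filter_upwards [Ioo_mem_nhdsGT (lt_of_lt_of_le one_pos hR)] with ε₀ hε₀
    exact (hsplit ε₀ hε₀.1 hε₀.2).symm
  -- `R → ∞`: `∫_{(0,∞)} F = 0`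
  have hR1 : Tendsto (fun R => ∫ t in (0 : ℝ)..R, F t) atTop (𝓝 (∫ t in Ioi 0, F t)) :=
    intervalIntegral_tendsto_integral_Ioi 0 hIF tendsto_id
  have hR2 : Tendsto (fun R => ∫ t in (0 : ℝ)..R, F t) atTop (𝓝 0) := by
    refine (tendsto_energy_bracket_atTop hlam hg hM hM0 hε hC hε1).congr' ?_
    filter_upwards [eventually_ge_atTop 1] with R hR
    exact (hzero R hR).symm
  have hF0 : ∫ t in Ioi 0, F t = 0 := tendsto_nhds_unique hR1 hR2
  -- split the integral of `F`
  have hF0' : ∫ t in Ioi 0, (Real.sinh (2 * t) * u' t ^ 2 + lam * (lam - 2) * (Real.sinh (2 * t) * u t ^ 2)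
      + Real.sinh (2 * t) * (g t * u t)) = 0 := hF0
  have hAB : IntegrableOn (fun t => Real.sinh (2 * t) * u' t ^ 2 + lam * (lam - 2) * (Real.sinh (2 * t) * u t ^ 2))
      (Ioi 0) := hI1.add (hI2.const_mul _)
  have hC' : IntegrableOn (fun t => Real.sinh (2 * t) * (g t * u t)) (Ioi 0) := hI3
  have hIA : IntegrableOn (fun t => lam * (lam - 2) * (Real.sinh (2 * t) * u t ^ 2)) (Ioi 0) := hI2.const_mul _
  have hI1' : IntegrableOn (fun t => Real.sinh (2 * t) * u' t ^ 2) (Ioi 0) := hI1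
  rw [integral_add hAB hC', integral_add hI1' hIA, MeasureTheory.integral_const_mul] at hF0'
  linarith

include hlam hg hM hM0 hε hC hε1 in
/-- The non-positivity `∫_{(0,∞)} sinh 2t · g · G^I_λ g ≤ 0` for `λ ≥ 2` (`μ ≥ 0`) and a source of rate `ε > 1`. -/
theorem inner_greenSolI_nonpos (h2 : 2 ≤ lam) :
    ∫ t in Ioi 0, Real.sinh (2 * t) * (g t * greenSolI (fun t => sph lam (hyp t)) (sphDecay lam) g t) ≤ 0 := by
  have h := energy_identity_class hlam hg hM hM0 hε hC hε1
  have h1 : 0 ≤ ∫ t in Ioi 0, Real.sinh (2 * t) * greenSolI' (deriv fun t => sph lam (hyp t)) (sphDecay' lam)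
      (fun t => sph lam (hyp t)) (sphDecay lam) g t ^ 2 := by
    apply setIntegral_nonneg measurableSet_Ioi
    intro t ht
    have ht0 : 0 < t := ht
    exact mul_nonneg (Real.sinh_nonneg_iff.mpr (by linarith)) (sq_nonneg _)
  have h2' : 0 ≤ ∫ t in Ioi 0, Real.sinh (2 * t) * greenSolI (fun t => sph lam (hyp t)) (sphDecay lam) g t ^ 2 := by
    apply setIntegral_nonneg measurableSet_Ioi
    intro t ht
    have ht0 : 0 < t := ht
    exact mul_nonneg (Real.sinh_nonneg_iff.mpr (by linarith)) (sq_nonneg _)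
  have hμ : 0 ≤ lam * (lam - 2) := mul_nonneg (by linarith) (by linarith)
  have := mul_nonneg hμ h2'
  linarith

end measure

end Summit.Ventures.HodgeRepro2.T5SU11ImproperEnergyIdentityAll
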